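import Mathlib
import Literature.MathematicalPhysics.QuantumFieldTheory.MirrorInPlaneConeSupport
import Literature.Analysis.Complex.TubeKernelCauchySchwarz
import Literature.Analysis.Complex.BoundedCrossTheoremTwoStrips
import HarnessLib

/-!
# The in-plane light cone of a mirror: holomorphic contraction family on the tube `|Im y| < Re t`

Topic `Literature/MathematicalPhysics/QuantumFieldTheory`.  Conclusion of the in-plane light-cone
argument for a correlation family `S : CorrFamily d` and a pair `n ⊥ n'` of vectors of equal length
such that `S` carries kernel-level Osterwalder–Schrader data (`MirrorOSData`) in the three frames
`n`, `n + n'`, `n - n'` (for the critical-Ising programme: a `B₂` pair of lattice mirror normals and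
its two bisectors), assuming the bounded cross theorem `Literature.Analysis.Complex.DiamondCross`
(`Literature/Analysis/Complex/BoundedCrossTheoremTwoStrips.lean`, proved there):

**`exists_holomorphic_twoCluster_of_bisectorOSData`** — for all finite real cluster combinations
`Σ c_a δ[A^a]`, `Σ d_b δ[B^b]` strictly inside `{⟪·, n⟫ > 0}` there is `G` holomorphic on the tube
`{(t, y) : |Im y| < Re t}` with `G(t, y) = Σ c_a d_b S(θ_n A^a ⊔ (B^b + t n + y n'))` for real `t > 0`,
`y`, and `‖G‖² ≤ (Σ c c' S(θ_n A ⊔ A')) (Σ d d' S(θ_n B ⊔ B'))` on the tube — the correlation-function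
form of "`e^{-tH + iyP}` is a holomorphic family of contractions on `|Im y| < Re t`", i.e. of the
spectral light cone `|P| ≤ H` (Glimm–Jaffe §19.5, here derived from bisector reflection positivity,
not from rotations).

Proof: `G` is the polarization combination of the Laplace–Fourier transforms of the joint spectral
measures of `ψ_{d ± c}`, `ψ_{d ± ic}` (`MirrorClusterOSSpace`), which are cone-supported
(`MirrorInPlaneConeSupport`) hence holomorphic and bounded on the tube (`LaplaceFourierCone`); the
sharp bound is the Cauchy–Schwarz inequality across the tube from Glaser positivity propagation
(`Literature.Analysis.Complex.norm_sq_le_re_mul_re_of_tube`), fed by Gram positivity at Euclidean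
points (`pairing_gram_nonneg`).

## References
* J. Glimm, A. Jaffe, *Quantum Physics* (2nd ed. 1987), §19.5. [folklore]
* K. Osterwalder, R. Schrader, Comm. Math. Phys. 31 (1973), §4. [folklore]
-/

noncomputable section

open scoped InnerProductSpace BigOperators ComplexConjugate
open Literature.Probability.LatticeModels Literature.Analysis.Complex Finset MeasureTheory Complex Set Metric

namespace Literature.MathematicalPhysics.QuantumFieldTheory

variable {d : ℕ} {S : CorrFamily d} {n n' : EuclideanSpace ℝ (Fin d)}

/-! ### Finite sums of functionals -/

section Sums

variable (S) (n') (hn' : ⟪n', n⟫_ℝ = 0)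

/-- `clusterPairing 0 c' = 0`. [folklore] -/
theorem clusterPairing_zero_left (c' : HalfSpaceCluster d n →₀ ℂ) (t s : ℝ) :
    clusterPairing S n' hn' 0 c' t s = 0 := by
  unfold clusterPairing; exact Finsupp.sum_zero_index

/-- `clusterPairing c 0 = 0`. [folklore] -/
theorem clusterPairing_zero_right (c : HalfSpaceCluster d n →₀ ℂ) (t s : ℝ) :
    clusterPairing S n' hn' c 0 t s = 0 := by
  simp [clusterPairing, Finsupp.sum]

/-- `clusterPairing` of a finite sum in the first functional. [folklore] -/
theorem clusterPairing_sum_left {ι : Type*} (s : Finset ι) (f : ι → (HalfSpaceCluster d n →₀ ℂ))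
    (c' : HalfSpaceCluster d n →₀ ℂ) (t u : ℝ) :
    clusterPairing S n' hn' (∑ i ∈ s, f i) c' t u = ∑ i ∈ s, clusterPairing S n' hn' (f i) c' t u := by
  classical
  induction s using Finset.induction_on with
  | empty => simp [clusterPairing_zero_left]
  | insert i s hi ih => rw [Finset.sum_insert hi, Finset.sum_insert hi, clusterPairing_add_left, ih]

/-- `clusterPairing` of a finite sum in the second functional. [folklore] -/
theorem clusterPairing_sum_right {ι : Type*} (s : Finset ι) (c : HalfSpaceCluster d n →₀ ℂ)
    (f : ι → (HalfSpaceCluster d n →₀ ℂ)) (t u : ℝ) :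
    clusterPairing S n' hn' c (∑ i ∈ s, f i) t u = ∑ i ∈ s, clusterPairing S n' hn' c (f i) t u := by
  classical
  induction s using Finset.induction_on with
  | empty => simp [clusterPairing_zero_right]
  | insert i s hi ih => rw [Finset.sum_insert hi, Finset.sum_insert hi, clusterPairing_add_right, ih]

/-- **Real cluster combinations**: for `Φ = Σ_a c_a δ_{x_a}`, `Ψ = Σ_b d_b δ_{y_b}` with real
coefficients, `clusterPairing Φ Ψ t u = Σ_a Σ_b c_a d_b K(x_a, y_b + u n' + (t∨0) n)`. [folklore] -/
theorem clusterPairing_realCombination {m m' : ℕ} (x : Fin m → HalfSpaceCluster d n) (c : Fin m → ℝ)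
    (y : Fin m' → HalfSpaceCluster d n) (e : Fin m' → ℝ) (t u : ℝ) :
    clusterPairing S n' hn' (∑ a, (c a : ℂ) • Finsupp.single (x a) 1) (∑ b, (e b : ℂ) • Finsupp.single (y b) 1) t u =
      ∑ a, ∑ b, (c a : ℂ) * e b *
        ((mirrorKernel S n (x a) (HalfSpaceCluster.shift n' hn' t u (y b)) : ℝ) : ℂ) := by
  rw [clusterPairing_sum_left]
  refine Finset.sum_congr rfl fun a _ => ?_
  rw [clusterPairing_sum_right]
  refine Finset.sum_congr rfl fun b _ => ?_
  rw [clusterPairing_smul_left, clusterPairing_smul_right, clusterPairing_single_single, Complex.conj_ofReal]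
  simp only [map_one, one_mul]
  ring

end Sums

/-! ### The holomorphic family -/

/-- **The in-plane light cone of a mirror with reflection-positive bisectors, correlation-function
form.**  Let `n ⊥ n'` have equal lengths and let `S` carry kernel-level OS data in the frames `n`,
`n + n'`, `n - n'`; assume `DiamondCross`.  For all finite real combinations of clusters
`A^a` (coefficients `c_a`) and `B^b` (coefficients `d_b`) strictly inside `{⟪·, n⟫ > 0}` there is
`G : ℂ² → ℂ` holomorphic on the tube `{|Im y| < Re t}` with
`G(t, y) = Σ_{a,b} c_a d_b S(θ_n A^a ⊔ (B^b + t n + y n'))` for real `t > 0`, `y ∈ ℝ`, and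
`‖G(t, y)‖² ≤ (Σ c_a c_{a'} S(θ_n A^a ⊔ A^{a'})) (Σ d_b d_{b'} S(θ_n B^b ⊔ B^{b'}))` on the tube
(Glimm–Jaffe §19.5: `e^{-tH+iyP}` is a holomorphic contraction family on `|Im y| < Re t`). [folklore] -/
theorem exists_holomorphic_twoCluster_of_bisectorOSData (hD : DiamondCross) (h₀ : MirrorOSData S n)
    (hb₁ : MirrorOSData S (n + n')) (hb₂ : MirrorOSData S (n - n')) (hnn' : ⟪n, n'⟫_ℝ = 0) (hlen : ‖n‖ = ‖n'‖)
    (m : ℕ) (k : Fin m → ℕ) (A : (a : Fin m) → Fin (k a) → EuclideanSpace ℝ (Fin d)) (c : Fin m → ℝ)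
    (m' : ℕ) (k' : Fin m' → ℕ) (B : (b : Fin m') → Fin (k' b) → EuclideanSpace ℝ (Fin d)) (dd : Fin m' → ℝ)
    (hA : ∀ a i, 0 < ⟪A a i, n⟫_ℝ) (hB : ∀ b j, 0 < ⟪B b j, n⟫_ℝ) :
    ∃ G : ℂ × ℂ → ℂ, DifferentiableOn ℂ G {p : ℂ × ℂ | |p.2.im| < p.1.re} ∧
      (∀ t y : ℝ, 0 < t → G ((t : ℂ), (y : ℂ)) =
        ((∑ a, ∑ b, c a * dd b * S (k a + k' b)
          (Fin.append (fun i => (ℝ ∙ n)ᗮ.reflection (A a i)) (fun j => B b j + t • n + y • n')) : ℝ) : ℂ)) ∧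
      (∀ p ∈ {p : ℂ × ℂ | |p.2.im| < p.1.re}, ‖G p‖ ^ 2 ≤
        (∑ a, ∑ a', c a * c a' * S (k a + k a') (Fin.append (fun i => (ℝ ∙ n)ᗮ.reflection (A a i)) (A a'))) *
        (∑ b, ∑ b', dd b * dd b' * S (k' b + k' b') (Fin.append (fun j => (ℝ ∙ n)ᗮ.reflection (B b j)) (B b')))) := by
  have hn : n ≠ 0 := h₀.normal_ne_zero
  have hn' : ⟪n', n⟫_ℝ = 0 := by rw [real_inner_comm]; exact hnn'
  -- the joint spectral measures of all functionals, cone-supported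
  have hex := fun f : HalfSpaceCluster d n →₀ ℂ => h₀.exists_spectralMeasure n' hn' f
  choose μ hμfin hμ0 hμrep hμuniv using hex
  have hcone : ∀ f, (μ f) {p | p 0 < |p 1|} = 0 := fun f =>
    haveI := hμfin f
    measure_cone_compl_eq_zero_of_bisectorOSData hD hb₁ hb₂ hn hn' hlen f (μ f) (hμ0 f) (hμrep f)
  -- the Laplace–Fourier transforms and their polarization combination
  set L : (HalfSpaceCluster d n →₀ ℂ) → ℂ × ℂ → ℂ := fun f q =>
    ∫ p, cexp (-(q.1 * p 0) + I * q.2 * p 1) ∂(μ f) with hL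
  set Bf : (HalfSpaceCluster d n →₀ ℂ) → (HalfSpaceCluster d n →₀ ℂ) → ℂ × ℂ → ℂ := fun f g q =>
    (1 / 4) * (L (g + f) q - L (g - f) q + I * L (g + I • f) q - I * L (g - I • f) q) with hBf
  have hLdiff : ∀ f, DifferentiableOn ℂ (L f) {p : ℂ × ℂ | |p.2.im| < p.1.re} := fun f => by
    haveI := hμfin f
    exact differentiableOn_integral_cexp_laplaceFourier (hcone f)
  have hBdiff : ∀ f g, DifferentiableOn ℂ (Bf f g) {p : ℂ × ℂ | |p.2.im| < p.1.re} := fun f g =>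
    (((hLdiff _).sub (hLdiff _)).add ((hLdiff _).const_mul I) |>.sub ((hLdiff _).const_mul I)).const_mul _
  have hLreal : ∀ f (t y : ℝ), 0 ≤ t → L f ((t : ℂ), (y : ℂ)) = clusterPairing S n' hn' f f t y :=
    fun f t y ht => (hμrep f t ht y).symm
  have hBreal : ∀ f g (t y : ℝ), 0 ≤ t → Bf f g ((t : ℂ), (y : ℂ)) = clusterPairing S n' hn' f g t y := by
    intro f g t y ht
    simp only [hBf, hLreal _ t y ht]
    exact (clusterPairing_polarization S n' hn' f g t y).symm
  -- Gram positivity at Euclidean points, Cauchy–Schwarz across the tube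
  open scoped ComplexOrder in
  have hpos : ∀ (M : ℕ) (cc : Fin M → (HalfSpaceCluster d n →₀ ℂ)) (t s : Fin M → ℝ) (γ : Fin M → ℂ),
      (∀ a, 0 < t a) → 0 ≤ ∑ a, ∑ b, conj (γ a) * γ b *
        Bf (cc a) (cc b) (((t a + t b : ℝ) : ℂ), ((s b - s a : ℝ) : ℂ)) := by
    intro M cc t s γ ht
    have e : ∀ a b, Bf (cc a) (cc b) (((t a + t b : ℝ) : ℂ), ((s b - s a : ℝ) : ℂ)) =
        clusterPairing S n' hn' (cc a) (cc b) (t a + t b) (s b - s a) := fun a b =>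
      hBreal _ _ _ _ (add_nonneg (ht a).le (ht b).le)
    simp_rw [e]
    exact h₀.pairing_gram_nonneg n' hn' cc t s γ fun a => (ht a).le
  have hCS := norm_sq_le_re_mul_re_of_tube Bf hBdiff hpos
  -- the diagonal values at `(t, iβ)`
  have hdiag : ∀ f (t β : ℝ), |β| ≤ t →
      0 ≤ (Bf f f ((t : ℂ), (β : ℂ) * I)).re ∧
        (Bf f f ((t : ℂ), (β : ℂ) * I)).re ≤ (clusterPairing S n' hn' f f 0 0).re := by
    intro f t β hβ
    have ht : 0 ≤ t := (abs_nonneg β).trans hβ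
    have hval : ∀ g, L g ((t : ℂ), (β : ℂ) * I) = ((∫ p, Real.exp (-(t * p 0) - β * p 1) ∂(μ g) : ℝ) : ℂ) :=
      fun g => integral_cexp_laplaceFourier_ofReal_mul_I t β
    have hIcc : ∀ g, ∫ p, Real.exp (-(t * p 0) - β * p 1) ∂(μ g) ∈ Icc 0 ((μ g).real univ) := fun g => by
      haveI := hμfin g
      exact integral_exp_neg_sub_mem_Icc (hcone g) hβ
    have h0 : (μ (f - f)).real univ = 0 := by
      rw [hμuniv, sub_self, clusterPairing_zero_left, Complex.zero_re]
    have h2 : (μ (f + f)).real univ = 4 * (clusterPairing S n' hn' f f 0 0).re := by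
      rw [hμuniv, clusterPairing_add_left, clusterPairing_add_right]
      simp only [Complex.add_re]
      ring
    have hre : (Bf f f ((t : ℂ), (β : ℂ) * I)).re = (1 / 4) * (∫ p, Real.exp (-(t * p 0) - β * p 1) ∂(μ (f + f)) -
        ∫ p, Real.exp (-(t * p 0) - β * p 1) ∂(μ (f - f))) := by
      simp only [hBf, hval]
      simp only [Complex.mul_re, Complex.sub_re, Complex.add_re, Complex.ofReal_re, Complex.ofReal_im,
        Complex.I_re, Complex.I_im, Complex.mul_im, Complex.sub_im, Complex.add_im]
      norm_num
    have hzero : ∫ p, Real.exp (-(t * p 0) - β * p 1) ∂(μ (f - f)) = 0 :=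
      le_antisymm (h0 ▸ (hIcc (f - f)).2) (hIcc (f - f)).1
    rw [hre, hzero, sub_zero]
    constructor
    · exact mul_nonneg (by norm_num) (hIcc (f + f)).1
    · have := (hIcc (f + f)).2
      rw [h2] at this
      linarith
  -- the functionals of the two real combinations
  set xA : Fin m → HalfSpaceCluster d n := fun a => ⟨k a, A a, hA a⟩ with hxA
  set xB : Fin m' → HalfSpaceCluster d n := fun b => ⟨k' b, B b, hB b⟩ with hxB
  set cA : HalfSpaceCluster d n →₀ ℂ := ∑ a, (c a : ℂ) • Finsupp.single (xA a) 1 with hcA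
  set dB : HalfSpaceCluster d n →₀ ℂ := ∑ b, (dd b : ℂ) • Finsupp.single (xB b) 1 with hdB
  have hnormA : (clusterPairing S n' hn' cA cA 0 0).re =
      ∑ a, ∑ a', c a * c a' * S (k a + k a') (Fin.append (fun i => (ℝ ∙ n)ᗮ.reflection (A a i)) (A a')) := by
    rw [hcA, clusterPairing_realCombination]
    have e : (∑ a, ∑ a', (c a : ℂ) * (c a' : ℂ) *
        ((mirrorKernel S n (xA a) (HalfSpaceCluster.shift n' hn' 0 0 (xA a')) : ℝ) : ℂ)) =
        ((∑ a, ∑ a', c a * c a' * S (k a + k a') (Fin.append (fun i => (ℝ ∙ n)ᗮ.reflection (A a i)) (A a')) : ℝ) : ℂ) := by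
      push_cast
      refine Finset.sum_congr rfl fun a _ => Finset.sum_congr rfl fun a' _ => ?_
      simp only [mirrorKernel, HalfSpaceCluster.shift_k, HalfSpaceCluster.shift_pts, zero_smul, max_self,
        add_zero]
      rfl
    rw [e, Complex.ofReal_re]
  have hnormB : (clusterPairing S n' hn' dB dB 0 0).re =
      ∑ b, ∑ b', dd b * dd b' * S (k' b + k' b') (Fin.append (fun j => (ℝ ∙ n)ᗮ.reflection (B b j)) (B b')) := by
    rw [hdB, clusterPairing_realCombination]
    have e : (∑ b, ∑ b', (dd b : ℂ) * (dd b' : ℂ) *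
        ((mirrorKernel S n (xB b) (HalfSpaceCluster.shift n' hn' 0 0 (xB b')) : ℝ) : ℂ)) =
        ((∑ b, ∑ b', dd b * dd b' * S (k' b + k' b') (Fin.append (fun j => (ℝ ∙ n)ᗮ.reflection (B b j)) (B b')) : ℝ) : ℂ) := by
      push_cast
      refine Finset.sum_congr rfl fun b _ => Finset.sum_congr rfl fun b' _ => ?_
      simp only [mirrorKernel, HalfSpaceCluster.shift_k, HalfSpaceCluster.shift_pts, zero_smul, max_self,
        add_zero]
      rfl
    rw [e, Complex.ofReal_re]
  refine ⟨Bf cA dB, hBdiff cA dB, fun t y ht => ?_, fun p hp => ?_⟩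
  · -- real points
    rw [hBreal _ _ t y ht.le, hcA, hdB, clusterPairing_realCombination]
    push_cast
    refine Finset.sum_congr rfl fun a _ => Finset.sum_congr rfl fun b _ => ?_
    congr 2
    simp only [mirrorKernel, HalfSpaceCluster.shift_k, HalfSpaceCluster.shift_pts, max_eq_left ht.le]
    congr 2
    funext j
    abel
  · -- the bound
    have hp' : |p.2.im| < p.1.re := hp
    have h1 := hCS cA dB (τ := p.1) (σ := p.2) hp'
    have hA' := hdiag cA p.1.re p.2.im hp'.le
    have hB' := hdiag dB p.1.re p.2.im hp'.le
    rw [← hnormA, ← hnormB]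
    calc ‖Bf cA dB p‖ ^ 2 = ‖Bf cA dB (p.1, p.2)‖ ^ 2 := rfl
      _ ≤ (Bf cA cA ((p.1.re : ℂ), (p.2.im : ℂ) * I)).re * (Bf dB dB ((p.1.re : ℂ), (p.2.im : ℂ) * I)).re := h1
      _ ≤ (clusterPairing S n' hn' cA cA 0 0).re * (clusterPairing S n' hn' dB dB 0 0).re :=
          mul_le_mul hA'.2 hB'.2 hB'.1 (hA'.1.trans hA'.2)

end Literature.MathematicalPhysics.QuantumFieldTheory
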